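/- Copyright: the b2b-balaban cell (near-miss cell 7), T⁴-continuum fan-out; row NE7b CRUX team (2), seat
t4-ne7b-formalise-leaf-05 (gen 34) — IR-46-2's standing division «… leaf-05 toy-instantiates» applied to leaf-02 g31's
IR-50-2 part 2 «THE KEY-SIDE DECORATION INSTANCE AT THE RECORD» (`HistoryRealiseCellsRunAssemblyWTVSDataLWK` ∕
`…AssemblyWTVSLWK`, OWNER g51 W-ne7bp1-g51-1), part 12 of the sanity series (`CLAIMS.log` l.34788).  Released under the licence of the surrounding project. -/
import Summits.QuantumFields.BalabanUV.T4Continuum.Support.HistoryRealiseCellsRunAssemblyWTVSSanityLWKToy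
import Summits.QuantumFields.BalabanUV.T4Continuum.Support.HistoryRealiseCellsRunAssemblyWTVSLWK

/-!
# Sanity for the (α) assembly, part 12: FILE 2's `HistReadDataLWK.toLWD` IS THE DECORATION JUNCTION AT THE KEY-SIDE CONSTRUCTOR
(`rfl`), THE ROUND TRIP TO THE LW RECORD (`rfl`), AND FILE 2's `toLWD` ∕ §2 RUN BY NAME ON THE TOY INHABITANT (companion of
`HistoryRealiseCellsRunAssemblyWTVSLWK`; lineage `t4-ne7b-formalise-leaf-05` gen 34)

Summits-side support leaf of the T⁴-continuum cell (rung (B)+1 on a FINITE torus only; NOT infinite volume, NOT the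
mass gap, NOT Clay; NOT a proof of NE7b — NOT PRINTED, NOT PROVED).  [decided toy] one-liners over parts 7∕9∕10∕11 and
leaf-02 g31's IR-50-2 FILE 2 (`HistReadDataLWK.toLWD`, `nonempty_countRoadWitnessT3bWTVSL_of_histReadingLWK`), REUSED BY
NAME; no new `def` but the named decorated toy record; nothing printed asserted, no `def … : Prop` fact, no cite-tagged
hypothesis, zero `sorry`.

§15 TWO RECORD EQUATIONS, generic (any LW record `Dl`, any key side on its letters): **`toLWD_toLWK`** — FILE 2's
`HistReadDataLWK.toLWD` of part 10's `Dl.toLWK kd…` IS part 9's `Dl.toLWD` at the key-side constructor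
`indexDecor_of_keySide Dl.ℛ Dl.Φf Dl.l₀ Dl.K₀ Dl.W Dl.φB Dl.φR (cellA …) (physA …) jhalf kd…` (`rfl`: refuter T-v20-1's
«`decor` assembled term-by-term from the twelve `kd…`» as a kernel fact — decorate-by-constructor, nothing else);
**`toLW_toLWD_toLWK`** — the custodian's `toLW` after both IS `Dl` again (`rfl`: 119 data∕display fields by projection, `hρ` by
proof irrelevance against `hρ_of_indexDecor (indexDecor_of_keySide …)`): the key side is FORGOTTEN EXACTLY into (ρ).
§16 **`histReadDataLWD_toyData_viaLWK`** := FILE 2's `toLWD` on part 11's `histReadDataLWK_toyData` — the decorated record at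
`Dc := Gen (PEv × Unit)`, `Sl := SIdx Isk` (leaf-03 g28's NOT-TO-FILE probe K4 `histReadDataLWD_keySide_toyData`, now through
the LWK record of record), `toLW_histReadDataLWD_toyData_viaLWK` (the toy round trip, `rfl`); FILE 2 §2
(`nonempty_countRoadWitnessT3bWTVSL_of_histReadingLWK`) RUN BY NAME on the toy beyond the two windows, and for SOME window run,
as two `example`s — their STATEMENTS coincide with part 9's `nonempty_∕exists_countRoadWitnessT3bWTVSL_toyData_viaLWD` (the
guarded witness forgets which road supplied (ρ)), which the gate's dedup rule reserves; the kernel runs the LWK road all the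
same.  FILE 2 §3's terminal theorem is NOT instantiable here: `hB` is FALSE on `toyData` (`not_endStatementBPrinted_toy`) —
said, not hidden.

HONEST.  By-name composition at toy letters (c2); certifies that FILE 2's embedding and §2 compose on an inhabitant and
WHAT the embedding is (`rfl`); nothing about Bałaban's index reading (ρ1), envelopes (ρ2) or share check (ρ3); (B) FAILS on
`toyData`; BY-NAME EFFECT ON THE WALL: NONE; NE7b NOT proved; spine 0∕9.  HONEST DEPENDENCY (cell): continuum YM on T⁴ ⇐
BetaPertH ∧ nine spine estimates (0/9 proved); BetaPertH ⇐ (D1) ∧ (D4) ∧ CAP+tail; G-an2-4 gates asym, D1 and NE2/3/4.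
Unchanged here.
-/


open Finset MeasureTheory
open Literature.MathematicalPhysics.QuantumFieldTheory.Balaban1983to89
open T4PersistenceDictionary T4PersistentHistoryCount T4BankedInduction T4PrintedShapeBanking
open T4WeightBudget T4GlobalDenominator T4LiveClassFibration T4LiveStructureGas T4LiveGasToTerms T4RecordPriceSeam
open T4PartnerMultiplicity T4IndicatorShell T4MatchingAssembly T4MatchingClosure T4MatchingClosureSocket T4Continuum
open T4StabilitySocket T4BranchingRecordsGas T4TaggedShapeBanking T4CanonicalMenus T4RenewalChains
open Literature.MathematicalPhysics.QuantumFieldTheory.Balaban1983to89.B13ScaleTransfer (Pt)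
open Summit.QuantumFields.BalabanUV.T4Continuum.HistoryFlow Summit.QuantumFields.BalabanUV.T4Continuum.HistoryGen
open Summit.QuantumFields.BalabanUV.T4Continuum.HistoryGenealogyRealise
open Summit.QuantumFields.BalabanUV.T4Continuum.HistoryGenealogyInstantiate
open Summit.QuantumFields.BalabanUV.T4Continuum.HistoryAssemblyTerms
open Summit.QuantumFields.BalabanUV.T4Continuum.HistoryAssemblyMult Summit.QuantumFields.BalabanUV.T4Continuum.HistoryAssemblyMultKey
open Summit.QuantumFields.BalabanUV.T4Continuum.HistorySocketTH
open Summit.QuantumFields.BalabanUV.T4Continuum.HistoryRealiseCellsRunApexT3bWTVS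
open Summit.QuantumFields.BalabanUV.T4Continuum.HistoryRealiseCellsRunApexT3bWTVSL
open Summit.QuantumFields.BalabanUV.T4Continuum.B16HistoryIndexedRepr
open Summit.QuantumFields.BalabanUV.T4Continuum.B16HistoryIndexedTrunc
open Summit.QuantumFields.BalabanUV.T4Continuum.HistoryConstants Summit.QuantumFields.BalabanUV.T4Continuum.HistoryBankingDiscountCharge
open Summit.QuantumFields.BalabanUV.T4Continuum.HistoryBankingCreditRead
open Summit.QuantumFields.BalabanUV.T4Continuum.HistoryBankingFibreRoom
open Summit.QuantumFields.BalabanUV.T4Continuum.HistoryBankingFibreResum (ncount ncount_born ncount_renew ncount_merge)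
open Summit.QuantumFields.BalabanUV.T4Continuum.HistoryPriceNodeSum Summit.QuantumFields.BalabanUV.T4Continuum.HistoryPriceKeys
open Summit.QuantumFields.BalabanUV.T4Continuum.HistoryRealiseCellsRunSupplyWTVS
open Summit.QuantumFields.BalabanUV.T4Continuum.HistoryRealiseCellsRunSupplyKeysWTVS
open Summit.QuantumFields.BalabanUV.T4Continuum.HistoryRealiseCellsRunSupplyWTVSSanity
open Summit.QuantumFields.BalabanUV.T4Continuum.HistoryRealiseCellsRunAssemblyWTVSData
open Summit.QuantumFields.BalabanUV.T4Continuum.HistoryRealiseCellsRunAssemblyWTVSDataL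
open Summit.QuantumFields.BalabanUV.T4Continuum.HistoryRealiseCellsRunAssemblyWTVSDataLW
open Summit.QuantumFields.BalabanUV.T4Continuum.HistoryRealiseCellsRunAssemblyWTVSDataLWD
open Summit.QuantumFields.BalabanUV.T4Continuum.HistoryRealiseCellsRunAssemblyWTVSDataLWK
open Summit.QuantumFields.BalabanUV.T4Continuum.HistoryRealiseCellsRunAssemblyWTVSLW
open Summit.QuantumFields.BalabanUV.T4Continuum.HistoryRealiseCellsRunAssemblyWTVSLWD
open Summit.QuantumFields.BalabanUV.T4Continuum.HistoryRealiseCellsRunAssemblyWTVSLWK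
open Summit.QuantumFields.BalabanUV.T4Continuum.HistoryRealiseCellsRunSupplyFibreWTVS
open Summit.QuantumFields.BalabanUV.T4Continuum.HistoryRealiseCellsRunSupplyFibreKeysWTVS
open Summit.QuantumFields.BalabanUV.T4Continuum.HistoryBankingFibreDecorKeys Summit.QuantumFields.BalabanUV.T4Continuum.HistoryBankingFibreDecorSlice
open Summit.QuantumFields.BalabanUV.T4Continuum.HistoryRealiseCellsRunApexWitness
open Summit.QuantumFields.BalabanUV.T4Continuum.HistoryBankingSharpShares (ell sBsharp)
open Summit.QuantumFields.BalabanUV.T4Continuum.HistoryBankingRoundingUnrounded (sRunr ApFlat)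
open Summit.QuantumFields.BalabanUV.T4Continuum.HistoryBankingRoundingSupply (ellStar)
open Summit.QuantumFields.BalabanUV.T4Continuum.HistoryBankingVolumeWindow (uvol lamVol jvol)
open Summit.QuantumFields.BalabanUV.T4Continuum.HistoryBankingVolumeSupply (ellVol)
open Missing AveragingRT

namespace Summit.QuantumFields.BalabanUV.T4Continuum.HistoryRealiseCellsRunAssemblyWTVSSanity

noncomputable section

open B16HistoryIndexedRepr.Sanity B16HistoryIndexedRepr.SanityInput HistoryConstants.Sanity

set_option synthInstance.maxSize 1024

/-! ## §15 FILE 2's embedding is the decoration junction at the key-side constructor; the round trip -/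

section Junction

variable {F : T4Family} {G : Type*} [GaugeGroup G] [MeasurableSpace G] [HaarData G] [RegularGaugeGroup G]
  {D : FiniteEpsData F G} {C : T4PrintedShapeBanking.Consts} {O : PrintedO1s} {θv : ℝ} {rr d n : ℕ} {hn : 0 < n}
  {g₀ : ℕ → ℝ} {os : List (ULoop F)} {cΛ Lr Φ β₀ : ℝ} {p₁ η η' κ κ₂ κᵥ : ℕ} {DomK : ℕ → Type}
  {I : (K : ℕ) → HIndex (DomK K)} [DecidableEq (HIndex.Idx I)] {DomK' : ℕ → Type} {I' : (K : ℕ) → HIndex (DomK' K)}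
  {Xs : ℕ → Type} [∀ K, MeasurableSpace (Xs K)] {μ : (K : ℕ) → Measure (Xs K)} [∀ K, IsFiniteMeasure (μ K)]
  {𝒢 : (K : ℕ) → GoodClass (Xs K)} {Y : ℕ → Type} [∀ K, MeasurableSpace (Y K)] {νB : (K : ℕ) → Measure (Y K)}
  [∀ K, IsFiniteMeasure (νB K)] {𝒢' : (K : ℕ) → GoodClass (Y K)} {β : Type} [DecidableEq β]

omit [RegularGaugeGroup G] in
/-- **FILE 2's `HistReadDataLWK.toLWD` IS part 9's JUNCTION `toLWD` AT THE KEY-SIDE CONSTRUCTOR** `indexDecor_of_keySide …`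
on the record's own key-side items (`rfl`). [folklore] -/
theorem toLWD_toLWK (Dd : HistReadDataLW D C O θv rr d n hn g₀ os cΛ Lr Φ β₀ p₁ η η' κ κ₂ κᵥ I I' Xs μ 𝒢 Y νB 𝒢')
    (kdC : ℕ → (Fin d → ℕ) × Gen PEv × Multiset (PEv × ((Fin d → ℕ) × Finset (Pt d))) → PEv → Finset β)
    (kdN : ℕ → PEv → ℕ)
    (kdDec : ℕ → HIndex.Idx I → (Fin d → ℕ) × Gen PEv × Multiset (PEv × ((Fin d → ℕ) × Finset (Pt d))) → Gen (PEv × β))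
    (kdV : ℕ → ℝ → Finset ((Fin d → ℕ) × Gen PEv × Multiset (PEv × ((Fin d → ℕ) × Finset (Pt d)))) → SIdx I → ℝ)
    {kdDied kdMem kdInj kdV0 kdEnv kdW kdCN kdShare} :
    (Dd.toLWK kdC kdN kdDec kdV kdDied kdMem kdInj kdV0 kdEnv kdW kdCN kdShare).toLWD =
      Dd.toLWD (indexDecor_of_keySide Dd.ℛ Dd.Φf Dd.l₀ Dd.K₀ Dd.W Dd.φB Dd.φR (cellA n F.L Dd.ℛ)
        (physA n F.L hn (lt_of_lt_of_le (by norm_num) (two_le_L F)) Dd.ℛ) jhalf kdC kdN kdDec kdV kdDied kdMem kdInj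
        kdV0 kdEnv kdW kdCN kdShare) :=
  rfl

omit [RegularGaugeGroup G] in
/-- **THE ROUND TRIP**: the custodian's `toLW` after FILE 2's `toLWD` after part 10's `toLWK` is the LW record itself — the
key side is forgotten EXACTLY into (ρ) (`hρ` by proof irrelevance against `hρ_of_indexDecor (indexDecor_of_keySide …)`;
`rfl`). [folklore] -/
theorem toLW_toLWD_toLWK (Dd : HistReadDataLW D C O θv rr d n hn g₀ os cΛ Lr Φ β₀ p₁ η η' κ κ₂ κᵥ I I' Xs μ 𝒢 Y νB 𝒢')
    (kdC : ℕ → (Fin d → ℕ) × Gen PEv × Multiset (PEv × ((Fin d → ℕ) × Finset (Pt d))) → PEv → Finset β)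
    (kdN : ℕ → PEv → ℕ)
    (kdDec : ℕ → HIndex.Idx I → (Fin d → ℕ) × Gen PEv × Multiset (PEv × ((Fin d → ℕ) × Finset (Pt d))) → Gen (PEv × β))
    (kdV : ℕ → ℝ → Finset ((Fin d → ℕ) × Gen PEv × Multiset (PEv × ((Fin d → ℕ) × Finset (Pt d)))) → SIdx I → ℝ)
    {kdDied kdMem kdInj kdV0 kdEnv kdW kdCN kdShare} :
    (Dd.toLWK kdC kdN kdDec kdV kdDied kdMem kdInj kdV0 kdEnv kdW kdCN kdShare).toLWD.toLW = Dd :=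
  rfl

end Junction

/-! ## §16 FILE 2 on the toy inhabitant: the decorated record, the guarded witness beyond the two windows -/

section ToyData

variable (F : T4Family) (G : Type) [GaugeGroup G] [MeasurableSpace G] [HaarData G] [RegularGaugeGroup G]

/-- **FILE 2's `HistReadDataLWK.toLWD` RUN BY NAME ON THE TOY**: the decorated record at `Dc := Gen (PEv × Unit)`,
`Sl := SIdx Isk` from part 11's key-side inhabitant. [decided toy] -/
def histReadDataLWD_toyData_viaLWK {S : ℕ} (hS : 1 ≤ S) {θv : ℝ} (hθv : 0 < θv) {cΛ Lr Φ : ℝ} (hcΛ : 0 ≤ cΛ)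
    (hLr : 0 ≤ Lr) (hΦ : 0 ≤ Φ) {β₀ : ℝ} (hβ₀ : 0 ≤ β₀) (n : ℕ) (hn : 0 < n) :
    HistReadDataLWD (toyData F G) C₃ O₁ θv 1 1 n hn (gW F.L S) ([] : List (ULoop F)) cΛ Lr Φ β₀ 4 2 1 1 1 3
      (Gen (PEv × Unit)) (SIdx Isk) Isk Isk (fun _ => Unit) μ₀ (fun _ => GoodClass.top Unit) (fun _ => Unit) μ₀
      (fun _ => GoodClass.top Unit) :=
  (histReadDataLWK_toyData F G hS hθv hcΛ hLr hΦ hβ₀ n hn).toLWD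

/-- the decorated record through the key side on the toy, as a `Nonempty` fact [decided toy] -/
theorem nonempty_histReadDataLWD_toyData_viaLWK {S : ℕ} (hS : 1 ≤ S) {θv : ℝ} (hθv : 0 < θv) {cΛ Lr Φ : ℝ}
    (hcΛ : 0 ≤ cΛ) (hLr : 0 ≤ Lr) (hΦ : 0 ≤ Φ) {β₀ : ℝ} (hβ₀ : 0 ≤ β₀) (n : ℕ) (hn : 0 < n) :
    Nonempty (HistReadDataLWD (toyData F G) C₃ O₁ θv 1 1 n hn (gW F.L S) ([] : List (ULoop F)) cΛ Lr Φ β₀ 4 2 1 1 1 3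
      (Gen (PEv × Unit)) (SIdx Isk) Isk Isk (fun _ => Unit) μ₀ (fun _ => GoodClass.top Unit) (fun _ => Unit) μ₀
      (fun _ => GoodClass.top Unit)) :=
  ⟨histReadDataLWD_toyData_viaLWK F G hS hθv hcΛ hLr hΦ hβ₀ n hn⟩

/-- **THE ROUND TRIP ON THE TOY**: forgetting the decoration of the key-side road gives back part 7's LW inhabitant (`rfl`).
[decided toy] -/
theorem toLW_histReadDataLWD_toyData_viaLWK {S : ℕ} (hS : 1 ≤ S) {θv : ℝ} (hθv : 0 < θv) {cΛ Lr Φ : ℝ} (hcΛ : 0 ≤ cΛ)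
    (hLr : 0 ≤ Lr) (hΦ : 0 ≤ Φ) {β₀ : ℝ} (hβ₀ : 0 ≤ β₀) (n : ℕ) (hn : 0 < n) :
    (histReadDataLWD_toyData_viaLWK F G hS hθv hcΛ hLr hΦ hβ₀ n hn).toLW =
      histReadDataLW_toyData F G hS hθv hcΛ hLr hΦ hβ₀ n hn :=
  rfl

/-- **FILE 2 §2 (LWK) RUN BY NAME ON IT** beyond the two windows: the GUARDED witness through the key-side road — an
`example` (the statement coincides with part 9's `nonempty_countRoadWitnessT3bWTVSL_toyData_viaLWD`, reserved by the gate's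
dedup rule; the kernel runs `nonempty_countRoadWitnessT3bWTVSL_of_histReadingLWK` on the LWK inhabitant all the same).
[decided toy] -/
example {S : ℕ} (hS : 1 ≤ S) {θv : ℝ} (hθv : 0 < θv) {cΛ Lr Φ : ℝ} (hcΛ : 0 ≤ cΛ) (hLr : 0 ≤ Lr) (hΦ : 0 ≤ Φ) {β₀ : ℝ}
    (hβ₀ : 0 ≤ β₀) (n : ℕ) (hn : 0 < n)
    (hr : ellStar C₃ O₁ F.L (O₁.d + 3) 2 1 1 (ApFlat O₁.γ₀ O₁.A₁ O₁.M Lr O₁.d) Φ ≤ (F.L : ℝ) ^ S)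
    (hv : ellVol C₃ 1 1 3 cΛ θv (1 + β₀) (jvol 1 (1 + β₀)) ≤ (F.L : ℝ) ^ S) :
    Nonempty (CountRoadWitnessT3bWTVSL (toyData F G) C₃ O₁ θv 1 1 n hn (gW F.L S) ([] : List (ULoop F)) (HIndex.Idx Isk)
      (ℕ × Lab 1) (Lab 1)) :=
  nonempty_countRoadWitnessT3bWTVSL_of_histReadingLWK (histReadDataLWK_toyData F G hS hθv hcΛ hLr hΦ hβ₀ n hn)
    (inInterval_toyData_gW F G hr) (inInterval_toyData_gW F G hv)

/-- **… and for SOME window run, UNCONDITIONALLY** (`exists_pow_windows`) — again an `example` (statement = part 9's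
`exists_countRoadWitnessT3bWTVSL_toyData_viaLWD`). [decided toy] -/
example {θv : ℝ} (hθv : 0 < θv) {cΛ Lr Φ : ℝ} (hcΛ : 0 ≤ cΛ) (hLr : 0 ≤ Lr) (hΦ : 0 ≤ Φ) {β₀ : ℝ} (hβ₀ : 0 ≤ β₀)
    (n : ℕ) (hn : 0 < n) :
    ∃ S : ℕ, Nonempty (CountRoadWitnessT3bWTVSL (toyData F G) C₃ O₁ θv 1 1 n hn (gW F.L S) ([] : List (ULoop F))
      (HIndex.Idx Isk) (ℕ × Lab 1) (Lab 1)) := by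
  obtain ⟨S, hS, hr, hv⟩ := exists_pow_windows F
    (ellStar C₃ O₁ F.L (O₁.d + 3) 2 1 1 (ApFlat O₁.γ₀ O₁.A₁ O₁.M Lr O₁.d) Φ) (ellVol C₃ 1 1 3 cΛ θv (1 + β₀) (jvol 1 (1 + β₀)))
  exact ⟨S, nonempty_countRoadWitnessT3bWTVSL_of_histReadingLWK (histReadDataLWK_toyData F G hS hθv hcΛ hLr hΦ hβ₀ n hn)
    (inInterval_toyData_gW F G hr) (inInterval_toyData_gW F G hv)⟩

/-- HONESTY CERTIFICATE (leaf-09's, re-read here): (B) FAILS on the toy datum, so FILE 2 §3's terminal theorem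
`continuumYM4Torus_of_histReadingLWK_fsc` (binder `hB`) has no instance on it. [decided toy] -/
example : ¬ B16.EndStatementBPrinted (toyData F G).C := not_endStatementBPrinted_toy F G

end ToyData

end

end Summit.QuantumFields.BalabanUV.T4Continuum.HistoryRealiseCellsRunAssemblyWTVSSanity
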